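import Literature.NumberTheory.LFunctions.WeilExplicitContinuous
import Literature.NumberTheory.LFunctions.WeilExplicitArchTermProofs
import Mathlib.MeasureTheory.Integral.ExpDecay
import Literature.MathematicalPhysics.QuantumFieldTheory.Sweep1AreaLawProofs
import HarnessLib

/-!
# T47 — Bombieri's form of the archimedean term for Lipschitz test functions

The tree proves `weilArchTermBombieri g = weilArchTerm g` (Bombieri 2000, (2.8):
`−(log 4π + γ)g(0) − ∫₀^∞ (e^{x/2}(g(x)+g(−x)) − 2g(0)) dx/(2 sinh x) = (1/2π)∫ ĝ(½+iu) Re ψ(¼+iu/2) du − g(0) log π`)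
for SMOOTH compactly supported `g` (`weilArchTermBombieri_eq_weilArchTerm_holds`). This file
extends it to LIPSCHITZ compactly supported `g` whose archimedean integrand is integrable
(`weilArchTermBombieri_eq_weilArchTerm_of_lipschitz`) — the class containing the tent `Δ_t`
of T45/T46. Proof: mollify (`WeilContinuous.moll`); `g ⋆ φ_k` is smooth, `L`-Lipschitz and
bounded by `sup ‖g‖` uniformly in `k`; the digamma side converges by the tree's
`tendsto_weilArchIntegral_moll`, Bombieri's integral by dominated convergence with the majorant
`C e^{−x}` (numerator `≤ (2L + K) x e^{x/2}` from the Lipschitz bound, `= −2g_k(0)` beyond the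
support).
-/

noncomputable section

open scoped Real Topology
open Complex Filter Set MeasureTheory Literature.NumberTheory.LFunctions
  Literature.NumberTheory.LFunctions.WeilContinuous

namespace Summit.RiemannHypothesis.RiemannHypothesis.Theorems

variable {g : ℝ → ℂ}

/-! ## Uniform Lipschitz and sup bounds along the mollification -/

/-- `(g ⋆ φ_k)(x) = ∫ g(x − v) φ_k(v) dv`. -/
theorem weilConv_moll_eq_integral (g : ℝ → ℂ) (k : ℕ) (x : ℝ) :
    weilConv g (moll k) x = ∫ v : ℝ, g (x - v) * moll k v := by
  rw [weilConv_apply]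
  have e : (fun u : ℝ ↦ g u * moll k (x - u)) =
      fun u : ℝ ↦ (fun v : ℝ ↦ g (x - v) * moll k v) (x - u) := by
    funext u; simp only [sub_sub_cancel]
  rw [e, integral_sub_left_eq_self (fun v : ℝ ↦ g (x - v) * moll k v) volume x]

/-- **Mollification preserves a Lipschitz bound**: if `‖g(x) − g(y)‖ ≤ L|x − y|` then the same holds
for `g ⋆ φ_k` (`∫ ‖φ_k‖ = 1`). -/
theorem norm_weilConv_moll_sub_le (hgc : Continuous g) {L : ℝ}
    (hL : ∀ x y : ℝ, ‖g x - g y‖ ≤ L * |x - y|) (k : ℕ) (x y : ℝ) :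
    ‖weilConv g (moll k) x - weilConv g (moll k) y‖ ≤ L * |x - y| := by
  have hmc := continuous_moll k
  have hint : ∀ z : ℝ, Integrable fun v : ℝ ↦ g (z - v) * moll k v := fun z ↦
    (by fun_prop : Continuous fun v : ℝ ↦ g (z - v) * moll k v).integrable_of_hasCompactSupport
      (hasCompactSupport_moll k).mul_left
  rw [weilConv_moll_eq_integral, weilConv_moll_eq_integral, ← integral_sub (hint x) (hint y)]
  have hb : ∀ v : ℝ, ‖g (x - v) * moll k v - g (y - v) * moll k v‖ ≤ L * |x - y| * ‖moll k v‖ := by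
    intro v
    rw [← sub_mul, norm_mul]
    refine mul_le_mul_of_nonneg_right ?_ (norm_nonneg _)
    have := hL (x - v) (y - v)
    rwa [show x - v - (y - v) = x - y by ring] at this
  calc ‖∫ v, (g (x - v) * moll k v - g (y - v) * moll k v)‖
      ≤ ∫ v, ‖g (x - v) * moll k v - g (y - v) * moll k v‖ := norm_integral_le_integral_norm _
    _ ≤ ∫ v, L * |x - y| * ‖moll k v‖ :=
        integral_mono_of_nonneg (Eventually.of_forall fun _ ↦ norm_nonneg _)
          ((integrable_norm_moll k).const_mul _) (Eventually.of_forall hb)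
    _ = L * |x - y| := by rw [MeasureTheory.integral_const_mul, integral_norm_moll, mul_one]

/-- **Mollification preserves the sup bound**: `‖(g ⋆ φ_k)(x)‖ ≤ sup ‖g‖`. -/
theorem norm_weilConv_moll_le {K : ℝ} (hK : ∀ x, ‖g x‖ ≤ K) (k : ℕ) (x : ℝ) :
    ‖weilConv g (moll k) x‖ ≤ K := by
  rw [weilConv_apply]
  have hb : ∀ u : ℝ, ‖g u * moll k (x - u)‖ ≤ K * ‖moll k (x - u)‖ := fun u ↦ by
    rw [norm_mul]; exact mul_le_mul_of_nonneg_right (hK u) (norm_nonneg _)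
  calc ‖∫ u, g u * moll k (x - u)‖ ≤ ∫ u, ‖g u * moll k (x - u)‖ := norm_integral_le_integral_norm _
    _ ≤ ∫ u, K * ‖moll k (x - u)‖ :=
        integral_mono_of_nonneg (Eventually.of_forall fun _ ↦ norm_nonneg _)
          (((integrable_norm_moll k).comp_sub_left x).const_mul K) (Eventually.of_forall hb)
    _ = K := by
        rw [MeasureTheory.integral_const_mul, integral_sub_left_eq_self (fun u ↦ ‖moll k u‖) volume x,
          integral_norm_moll, mul_one]

/-! ## Bombieri's numerator under a Lipschitz bound -/

/-- **Bombieri's numerator is `O(x)` for a Lipschitz function**: if `‖h(a) − h(b)‖ ≤ L|a − b|` and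
`‖h(0)‖ ≤ K` then `‖e^{x/2}(h(x) + h(−x)) − 2h(0)‖ ≤ (2L + K) x e^{x/2}` for `x ≥ 0`. -/
theorem norm_bombieriNumerator_le_of_lipschitz {h : ℝ → ℂ} {L K : ℝ}
    (hL : ∀ a b : ℝ, ‖h a - h b‖ ≤ L * |a - b|) (hK : ‖h 0‖ ≤ K) {x : ℝ} (hx : 0 ≤ x) :
    ‖(Real.exp (x / 2) : ℂ) * (h x + h (-x)) - 2 * h 0‖ ≤ (2 * L + K) * x * Real.exp (x / 2) := by
  have hE : 0 < Real.exp (x / 2) := Real.exp_pos _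
  have hE1 : 1 ≤ Real.exp (x / 2) := Real.one_le_exp (by positivity)
  have hK0 : 0 ≤ K := (norm_nonneg _).trans hK
  have e : (Real.exp (x / 2) : ℂ) * (h x + h (-x)) - 2 * h 0 =
      (Real.exp (x / 2) : ℂ) * ((h x - h 0) + (h (-x) - h 0)) +
        ((Real.exp (x / 2) : ℂ) - 1) * (2 * h 0) := by ring
  rw [e]
  have h1 : ‖h x - h 0‖ ≤ L * x := by simpa [abs_of_nonneg hx] using hL x 0
  have h2 : ‖h (-x) - h 0‖ ≤ L * x := by simpa [abs_of_nonneg hx] using hL (-x) 0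
  have h3 : ‖(Real.exp (x / 2) : ℂ) - 1‖ = Real.exp (x / 2) - 1 := by
    rw [← Complex.ofReal_one, ← Complex.ofReal_sub, Complex.norm_real,
      Real.norm_of_nonneg (by linarith)]
  have h4 : Real.exp (x / 2) - 1 ≤ x / 2 * Real.exp (x / 2) :=
    Literature.MathematicalPhysics.QuantumFieldTheory.AreaLaw.exp_sub_one_le_mul_exp (x / 2)
  have h5 : ‖(2 : ℂ) * h 0‖ ≤ 2 * K := by
    rw [norm_mul, RCLike.norm_ofNat]; linarith
  calc ‖(Real.exp (x / 2) : ℂ) * ((h x - h 0) + (h (-x) - h 0)) +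
          ((Real.exp (x / 2) : ℂ) - 1) * (2 * h 0)‖
      ≤ ‖(Real.exp (x / 2) : ℂ) * ((h x - h 0) + (h (-x) - h 0))‖ +
          ‖((Real.exp (x / 2) : ℂ) - 1) * (2 * h 0)‖ := norm_add_le _ _
    _ ≤ Real.exp (x / 2) * (L * x + L * x) + (Real.exp (x / 2) - 1) * (2 * K) := by
        rw [norm_mul, norm_mul, Complex.norm_real, Real.norm_of_nonneg hE.le, h3]
        exact add_le_add
          (mul_le_mul_of_nonneg_left ((norm_add_le _ _).trans (add_le_add h1 h2)) hE.le)
          (mul_le_mul_of_nonneg_left h5 (by linarith))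
    _ ≤ Real.exp (x / 2) * (L * x + L * x) + (x / 2 * Real.exp (x / 2)) * (2 * K) := by
        have := mul_le_mul_of_nonneg_right h4 (by linarith : (0 : ℝ) ≤ 2 * K)
        linarith
    _ = (2 * L + K) * x * Real.exp (x / 2) := by ring

/-! ## The theorem -/

/-- **Bombieri's form of the archimedean term for Lipschitz compactly supported test functions.**
If `g : ℝ → ℂ` is continuous with compact support, `‖g(x) − g(y)‖ ≤ L|x − y|`, and
`u ↦ ĝ(½+iu) Re ψ(¼+iu/2)` is integrable, then
`−(log 4π + γ)g(0) − ∫₀^∞ (e^{x/2}(g(x)+g(−x)) − 2g(0)) dx/(2 sinh x) = (1/2π)∫ ĝ(½+iu) Re ψ(¼+iu/2) du − g(0) log π`,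
i.e. `weilArchTermBombieri g = weilArchTerm g`. -/
theorem weilArchTermBombieri_eq_weilArchTerm_of_lipschitz (hgc : Continuous g)
    (hgs : HasCompactSupport g) {L : ℝ} (hL : ∀ x y : ℝ, ‖g x - g y‖ ≤ L * |x - y|)
    (hA : Integrable fun u : ℝ ↦ weilMellin g (1 / 2 + u * I) *
      ((Complex.digamma (1 / 4 + u / 2 * I)).re : ℂ)) :
    weilArchTermBombieri g = weilArchTerm g := by
  obtain ⟨K, hK⟩ := hgc.bounded_above_of_compact_support hgs
  have hK0 : 0 ≤ K := (norm_nonneg _).trans (hK 0)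
  have hL0 : 0 ≤ L := by
    have h := hL 1 0
    have h' : (0 : ℝ) ≤ ‖g 1 - g 0‖ := norm_nonneg _
    norm_num at h
    linarith
  obtain ⟨R, hR0, hR⟩ := exists_support_radius hgs
  have hLk : ∀ (k : ℕ) (x y : ℝ), ‖weilConv g (moll k) x - weilConv g (moll k) y‖ ≤ L * |x - y| :=
    fun k ↦ norm_weilConv_moll_sub_le hgc hL k
  have hKk : ∀ (k : ℕ) (x : ℝ), ‖weilConv g (moll k) x‖ ≤ K := fun k ↦ norm_weilConv_moll_le hK k
  -- (1) Bombieri's identity for each mollified (smooth) function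
  have hB : ∀ k : ℕ, weilArchTermBombieri (weilConv g (moll k)) = weilArchTerm (weilConv g (moll k)) :=
    fun k ↦ weilArchTermBombieri_eq_weilArchTerm_holds (isWeilTest_weilConv_moll hgc hgs k)
  -- (2) the digamma side converges
  have hW : Tendsto (fun k ↦ weilArchTerm (weilConv g (moll k))) atTop (𝓝 (weilArchTerm g)) := by
    unfold weilArchTerm
    exact ((tendsto_weilArchIntegral_moll hgc hgs hA).const_mul _).sub
      ((tendsto_weilConv_moll hgc 0).mul_const _)
  -- (3) Bombieri's integral converges (dominated convergence)
  have hI : Tendsto (fun k ↦ ∫ x in Ioi (0 : ℝ),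
      ((Real.exp (x / 2) : ℂ) * (weilConv g (moll k) x + weilConv g (moll k) (-x)) -
        2 * weilConv g (moll k) 0) / (2 * Real.sinh x : ℂ)) atTop
      (𝓝 (∫ x in Ioi (0 : ℝ), ((Real.exp (x / 2) : ℂ) * (g x + g (-x)) - 2 * g 0) /
        (2 * Real.sinh x : ℂ))) := by
    set C : ℝ := (2 * L + K) * Real.exp (3 * (R + 1) / 2) + 4 * K with hC
    have hC1 : (2 * L + K) * Real.exp (3 * (R + 1) / 2) ≤ C := by rw [hC]; linarith
    have hC2 : 4 * K ≤ C := by rw [hC]; nlinarith [Real.exp_pos (3 * (R + 1) / 2)]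
    refine tendsto_integral_of_dominated_convergence (fun x ↦ C * Real.exp (-1 * x))
      (fun k ↦ ?_) ((exp_neg_integrableOn_Ioi 0 zero_lt_one).const_mul C) (fun k ↦ ?_) ?_
    · -- measurability
      have hc1 : Continuous (weilConv g (moll k)) := (isWeilTest_weilConv_moll hgc hgs k).1.continuous
      refine ContinuousOn.aestronglyMeasurable ?_ measurableSet_Ioi
      refine (by fun_prop : Continuous fun x : ℝ ↦ (Real.exp (x / 2) : ℂ) *
          (weilConv g (moll k) x + weilConv g (moll k) (-x)) - 2 * weilConv g (moll k) 0).continuousOn.div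
        (by fun_prop : Continuous fun x : ℝ ↦ (2 * Real.sinh x : ℂ)).continuousOn fun x hx ↦ ?_
      have : 0 < Real.sinh x := Real.sinh_pos_iff.2 hx
      exact_mod_cast (by positivity : 2 * Real.sinh x ≠ 0)
    · -- domination
      refine (ae_restrict_iff' measurableSet_Ioi).2 (Eventually.of_forall fun x (hx : 0 < x) ↦ ?_)
      have hsinh : 0 < Real.sinh x := Real.sinh_pos_iff.2 hx
      have hden : ‖(2 * Real.sinh x : ℂ)‖ = 2 * Real.sinh x := by
        rw [show (2 * Real.sinh x : ℂ) = ((2 * Real.sinh x : ℝ) : ℂ) by push_cast; rfl,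
          Complex.norm_real, Real.norm_of_nonneg (by positivity)]
      have hex : 0 < Real.exp (-1 * x) := Real.exp_pos _
      rw [norm_div, hden, div_le_iff₀ (by positivity)]
      rcases le_or_gt x (R + 1) with hx1 | hx1
      · -- near zero / on the support: the numerator is `≤ (2L+K) x e^{x/2}`
        have hnum := norm_bombieriNumerator_le_of_lipschitz (hLk k) (hKk k 0) hx.le
        have e1 : x ≤ Real.sinh x := Real.self_le_sinh_iff.2 hx.le
        have e2 : Real.exp (x / 2) * Real.exp x ≤ Real.exp (3 * (R + 1) / 2) := by
          rw [← Real.exp_add]; exact Real.exp_le_exp.2 (by linarith)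
        have e3 : Real.exp x * Real.exp (-1 * x) = 1 := by rw [← Real.exp_add]; simp
        have hCe : (2 * L + K) * Real.exp (x / 2) ≤ C * Real.exp (-1 * x) := by
          have h2LK : 0 ≤ 2 * L + K := by linarith
          calc (2 * L + K) * Real.exp (x / 2)
              = (2 * L + K) * (Real.exp (x / 2) * Real.exp x) * Real.exp (-1 * x) := by
                rw [mul_assoc (2 * L + K), mul_assoc (Real.exp (x / 2)), e3, mul_one]
            _ ≤ (2 * L + K) * Real.exp (3 * (R + 1) / 2) * Real.exp (-1 * x) := by gcongr
            _ ≤ C * Real.exp (-1 * x) := by gcongr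
        calc ‖(Real.exp (x / 2) : ℂ) * (weilConv g (moll k) x + weilConv g (moll k) (-x)) -
              2 * weilConv g (moll k) 0‖
            ≤ (2 * L + K) * x * Real.exp (x / 2) := hnum
          _ = (2 * L + K) * Real.exp (x / 2) * x := by ring
          _ ≤ C * Real.exp (-1 * x) * Real.sinh x :=
              mul_le_mul hCe e1 hx.le (by positivity)
          _ ≤ C * Real.exp (-1 * x) * (2 * Real.sinh x) := by
              have hC0 : 0 ≤ C := by linarith
              nlinarith [mul_nonneg hC0 hex.le]
      · -- beyond the support: the numerator is `−2 g_k(0)`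
        have hx' : R + 1 < |x| := by rwa [abs_of_pos hx]
        have hz1 : weilConv g (moll k) x = 0 := weilConv_moll_eq_zero hR hx' k
        have hz2 : weilConv g (moll k) (-x) = 0 := weilConv_moll_eq_zero hR (by rwa [abs_neg]) k
        rw [hz1, hz2, add_zero, mul_zero, zero_sub, norm_neg]
        have hn : ‖(2 : ℂ) * weilConv g (moll k) 0‖ ≤ 2 * K := by
          rw [norm_mul, RCLike.norm_ofNat]; linarith [hKk k 0]
        have hex1 : Real.exp (-x) ≤ 1 := Real.exp_le_one_iff.2 (by linarith)
        have hex2 : (2 : ℝ) ≤ Real.exp x := by linarith [Real.add_one_le_exp x]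
        have h2s : Real.exp x / 2 ≤ 2 * Real.sinh x := by rw [Real.sinh_eq]; linarith
        have e3 : Real.exp (-1 * x) * Real.exp x = 1 := by rw [← Real.exp_add]; simp
        calc ‖(2 : ℂ) * weilConv g (moll k) 0‖ ≤ 2 * K := hn
          _ = 4 * K * Real.exp (-1 * x) * (Real.exp x / 2) := by
              rw [show 4 * K * Real.exp (-1 * x) * (Real.exp x / 2) =
                2 * K * (Real.exp (-1 * x) * Real.exp x) by ring, e3, mul_one]
          _ ≤ C * Real.exp (-1 * x) * (Real.exp x / 2) := by gcongr
          _ ≤ C * Real.exp (-1 * x) * (2 * Real.sinh x) := by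
              have hC0 : 0 ≤ C := by linarith
              exact mul_le_mul_of_nonneg_left h2s (by positivity)
    · -- pointwise convergence
      refine (ae_restrict_iff' measurableSet_Ioi).2 (Eventually.of_forall fun x (_ : 0 < x) ↦ ?_)
      have h1 := tendsto_weilConv_moll hgc x
      have h2 := tendsto_weilConv_moll hgc (-x)
      have h0 := tendsto_weilConv_moll hgc 0
      exact (((h1.add h2).const_mul _).sub (h0.const_mul _)).div_const _
  have hBl : Tendsto (fun k ↦ weilArchTermBombieri (weilConv g (moll k))) atTop
      (𝓝 (weilArchTermBombieri g)) := by
    unfold weilArchTermBombieri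
    exact (((tendsto_weilConv_moll hgc 0).const_mul _).add hI).neg
  -- (4) uniqueness of limits
  have e : (fun k ↦ weilArchTermBombieri (weilConv g (moll k))) =
      fun k ↦ weilArchTerm (weilConv g (moll k)) := funext hB
  rw [e] at hBl
  exact tendsto_nhds_unique hBl hW

end Summit.RiemannHypothesis.RiemannHypothesis.Theorems

end
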